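/-
Copyright (c) 2026 the pub-hodgecm-mathlib formalisation cell (harness21).  Prover seat hodgecm-mathlib-K2E3-p37 (g0), Track B «K2-LIT» ∕ h413 =
`stmt-HodgeConjecture-24833`, line `K2_E3_EllipticInputs`, unit U4 «Keys», PART «U4Keys» socket :182 (U4f-χ₁-ram-one-pos)
`sig_K2E3KeysThmTwoContractingRamifiedCharOnePosDepth` (LINE-LEAD K2E3-plan (g4) L4∕E3 EMIT #5 deal D163 2026-09-04T15:31:56Z; R0 census + addenda §6–§9
`K2/K2E3-p37/g0/CENSUS-U4f-PosDepth.K2E3-p37-g0.md`): programme A_pos^{=} brick (iii)-Z «THE DEPTH WITNESS OF FAMILY Z» — for an intermediate lower unipotent `ū(x, z)` with `z`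
shallow (`|ϖ|ᵐ ≤ |z|`, `|x|² ≤ |z||ϖ|`) and a `σ`-FIXED `c ∈ 𝔭ᵐ`, the element `u(0, b)`, `b = c(z⁻¹ − (σz)⁻¹)∕2`, conjugates into `J_{m+1}` with `(0,0)` entry `(1 + c)(1 + ε)`, `ε ∈ 𝔭^{m+1}`.
REPORT-FIRST 2026-09-04.
-/
import Summits.HodgeConjecture.HodgeConjecture.Theorems.K2E3LowerUnipotentConjUpperEntries   -- ★∕📤 p861919 (this seat): the entries of `ū⁻¹ u ū`; brings ★ p861613 (`exists_upper_of_rel`), ★ p861548 (`J_n` test), ★ BigCell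
import HarnessLib

/-!
# K2 ∕ E3 «EllipticInputs», unit U4 «Keys» — (U4f-χ₁-ram-one-pos), programme A_pos^{=} brick (iii)-Z: THE DEPTH WITNESS ON AN INTERMEDIATE CELL, FAMILY Z
# «`ū = ū(x,z)`, `|x| ≤ |ϖ|`, `|ϖ|ᵐ ≤ |z| ≤ |ϖ|`, `|x|² ≤ |z|·|ϖ|`, `σc = c`, `|c| ≤ |ϖ|ᵐ`, `|2| = 1` ⟹ `u := u(0, c(z⁻¹ − (σz)⁻¹)∕2) ∈ N ∩ K₀`, `ū⁻¹ u ū ∈ J_{m+1}`,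
#  `(ū⁻¹ u ū)₀₀ = (1 + c)(1 + ε)` with `|ε| ≤ |ϖ|^{m+1}`»   [Roche1998 §4; Casselman1995 §6.3; Rogawski1990 §1.10]

Cell hodgecm-mathlib, Track B «K2-LIT», crux item H413 = stmt-HodgeConjecture-24833 (route `HCCMUnconditional`, no route verbs); target BY NAME the OPEN tier-0 leaf
`…K2E3EllipticInputs.U4Keys.sig_K2E3KeysThmTwoContractingRamifiedCharOnePosDepth` (U4Keys ED. 8 :182), design D-I «vanishing functional» at POSITIVE depth, sub-case A_pos^{=}
(cond(`χ₁|_{F^×}`) = cond `χ₁` = `m + 1`, `|2|_w = 1`; memo §9).  Author K2E3-p37 (g0).  `--supports stmt-HodgeConjecture-24833 --as helper`; THEOREMS ONLY; MODEL level.  NOT THE PAYER.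

THE POINT.  In the cell family `R = N̄ ∖ J_n` of ★ p861573 (`n = m + 1`), a lower unipotent `ū(x, z)` with `|z| < 1` (off the big cell ★ p861613) and `|ϖ|ᵐ ≤ |z|` (off `J_n` through its
`(2,0)` entry) in the regime `|x|² ≤ |z||ϖ|` («`2·ord x ≥ ord z + 1`», memo §9 case (1)) needs a DEPTH WITNESS.  Given `c` with `σc = c`, `|c| ≤ |ϖ|ᵐ` — in the assembly `c` is chosen
with `χ₁(1 + c) ≠ 1`, which exists iff cond(`χ₁|_{F^×}`) = `m + 1` — put `b := c(z⁻¹ − (σz)⁻¹)∕2` (IMAGINARY: `b + σb = 0`), `u := u(0, b) ∈ N` (★ `exists_upper_of_rel`) and `j := ū⁻¹ u ū`.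
By ★∕📤 p861919 (`y = 0`): `j₀₀ = 1 + bz`, `j₁₀ = σx·bz`, `j₂₀ = σz·bz`, `j₂₁ = (bz)·x·(σz∕z)`, and the KEY IDENTITY `bz = c + δ`, `δ = c·xσx∕(2σz)` (from `σz = −z − xσx`), with
`|δ| = |c||x|²∕|z| ≤ |ϖ|ᵐ·|ϖ| = |ϖ|^{m+1}`; hence `|bz| ≤ |ϖ|ᵐ`, the three lower entries of `j` are `≤ |ϖ|^{m+1}`, `j` is integral (`ū, u ∈ K₀`: `|b| = |bz|∕|z| ≤ |ϖ|ᵐ∕|z| ≤ 1`), so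
`j ∈ J_{m+1}` by the level test ★ p861548, and `j₀₀ = 1 + c + δ = (1 + c)(1 + ε)`, `ε = δ∕(1+c)`, `|ε| = |δ| ≤ |ϖ|^{m+1}`.  With ★∕📤 p861880 `theta_mul_pow`-type reading,
`θ(j) = χ₁(j₀₀) = χ₁(1+c)·χ₁(1+ε) = χ₁(1+c) ≠ 1 = (χδ^{½})(u)`: the witness of ★ p861573's letter `hwit` on this cell.
* §1 `familyZ_rel` (`b + σb = 0`), `familyZ_mul_eq` ∕ `familyZ_sub_mul_eq` (`bz·2σz = c·2σz + c·xσx`), `familyZ_v_bz_le` (`|bz| ≤ |ϖ|ᵐ`), `familyZ_v_sub_le` (`|bz − c| ≤ |ϖ|^{m+1}`).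
* §2 **`exists_familyZ_witness`** — `∃ u ∈ N`, `ū⁻¹ u ū ∈ J_{m+1}` and `∃ ε, |ε| ≤ |ϖ|^{m+1} ∧ (ū⁻¹ u ū)₀₀ = (1 + c)(1 + ε)`.
HONEST LABEL: HC_CM is proved only modulo the 7 printed citations (2 remaining named inputs: hLiu418 = stmt-HodgeConjecture-24832, h413 = stmt-HodgeConjecture-24833)
until rung 0 closes; count-neutral — this file does NOT pay the leaf; no printed citation is discharged.

## References
* [Roche1998] A. Roche, *Types and Hecke algebras for principal series representations of split reductive p-adic groups*, Ann. Sci. ÉNS (4) 31 (1998), §4.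
* [Casselman1995] W. Casselman, *Introduction to the theory of admissible representations of `p`-adic reductive groups* (1995), §6.3.
* [Rogawski1990] J. D. Rogawski, *Automorphic Representations of Unitary Groups in Three Variables*, Ann. of Math. Stud. 123 (1990), §1.9–§1.10 pp. 8–9.
* [Serre1979] J.-P. Serre, *Local Fields*, GTM 67 (1979), Ch. II §1.
-/

set_option autoImplicit false
-- the mandated namespace repeats the single-problem summit's segment (`HodgeConjecture.HodgeConjecture`)
set_option linter.dupNamespace false

noncomputable section

open Matrix Literature.NumberTheory.Automorphic Literature.NumberTheory.Automorphic.UnitaryGroup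
open scoped Matrix MatrixGroups WithZero Pointwise

namespace Summit.HodgeConjecture.HodgeConjecture.Cruxes.H413.K2E3LevelNDepthWitnessZ

open Summit.HodgeConjecture.HodgeConjecture.Cruxes.H413

/-! ## §1 Algebra and valuations of family Z -/

section Algebra

variable {K : Type*} [Field K] (σ : K →+* K) (hσ : ∀ a, σ (σ a) = a)

include hσ in
/-- **Family Z is imaginary**: for `σc = c`, `b := c(z⁻¹ − (σz)⁻¹)∕2` satisfies `b + σb = 0` (so `u(0, b) ∈ N`). [cite: Rogawski1990, §1.10 p. 9] -/
theorem familyZ_rel {c z b : K} (hσc : σ c = c) (hb : b = c * (z⁻¹ - (σ z)⁻¹) / 2) :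
    b + σ b + 0 * σ 0 = 0 := by
  rw [hb, map_div₀, map_mul, map_sub, map_inv₀, map_inv₀, hσ, hσc, map_ofNat]
  ring

/-- **THE KEY IDENTITY `bz·(2σz) = c·(2σz) + c·xσx`** (i.e. `bz = c + c·xσx∕(2σz)`) for `b = c(z⁻¹ − (σz)⁻¹)∕2` on `ū(x, z)` (`z + σz + xσx = 0`).
[cite: Rogawski1990, §1.10 p. 9] -/
theorem familyZ_mul_eq {c x z b : K} (hrel : z + σ z + x * σ x = 0) (hz : z ≠ 0) (hσz : σ z ≠ 0) (h2 : (2 : K) ≠ 0)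
    (hb : b = c * (z⁻¹ - (σ z)⁻¹) / 2) :
    b * z * (2 * σ z) = c * (2 * σ z) + c * (x * σ x) := by
  have h1 : b * z * (2 * σ z) = c * (σ z - z) := by
    rw [hb]
    field_simp
  rw [h1]
  linear_combination (-c) * hrel

/-- `(bz − c)·(2σz) = c·xσx`. [cite: Rogawski1990, §1.10 p. 9] -/
theorem familyZ_sub_mul_eq {c x z b : K} (hrel : z + σ z + x * σ x = 0) (hz : z ≠ 0) (hσz : σ z ≠ 0) (h2 : (2 : K) ≠ 0)
    (hb : b = c * (z⁻¹ - (σ z)⁻¹) / 2) :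
    (b * z - c) * (2 * σ z) = c * (x * σ x) := by
  linear_combination familyZ_mul_eq σ hrel hz hσz h2 hb

end Algebra

section Valuation

variable {K : Type*} [Field K] [Valued K ℤᵐ⁰] [ValuativeRel K] [(Valued.v : Valuation K ℤᵐ⁰).Compatible]
  (σ : K →+* K) {ϖ : K} {J : Matrix (Fin 3) (Fin 3) K} (hJ : J = (StdForm.antidiagonal 3).over K)
  (hσ : ∀ a, σ (σ a) = a) (hvσ : ∀ a, Valued.v (σ a) = Valued.v a) (hvϖ : Valued.v ϖ = WithZero.exp (-1 : ℤ))
  {m : ℕ} (gn : GL (Fin 3) K) (hgn : (gn : Matrix (Fin 3) (Fin 3) K) = Matrix.diagonal ![(1 : K), 1, ϖ ^ (m + 1)])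

omit [ValuativeRel K] [(Valued.v : Valuation K ℤᵐ⁰).Compatible] in
/-- Cancelling a non-zero valuation on the right. [folklore] -/
theorem le_of_mul_le_mul_v {A B C : ℤᵐ⁰} (h : A * C ≤ B * C) (hC : C ≠ 0) : A ≤ B := by
  have h' := mul_le_mul' h (le_refl C⁻¹)
  rwa [mul_inv_cancel_right₀ hC, mul_inv_cancel_right₀ hC] at h'

omit [ValuativeRel K] [(Valued.v : Valuation K ℤᵐ⁰).Compatible] in
include hvσ in
/-- **`|bz| ≤ |c| ≤ |ϖ|ᵐ`**: `|bz|·|2σz| = |c·(2σz) + c·xσx| ≤ |c|·|z|` (`|x|² ≤ |z||ϖ| ≤ |z|`, `|2| = 1`). [cite: Serre1979, Ch. II §1] -/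
theorem familyZ_v_bz_le {c x z b : K} (hrel : z + σ z + x * σ x = 0) (hc : Valued.v c ≤ Valued.v ϖ ^ m)
    (hxz : Valued.v x * Valued.v x ≤ Valued.v z * Valued.v ϖ) (h2 : Valued.v (2 : K) = 1) (hz : z ≠ 0) (hvϖ1 : Valued.v ϖ ≤ 1)
    (hb : b = c * (z⁻¹ - (σ z)⁻¹) / 2) :
    Valued.v (b * z) ≤ Valued.v ϖ ^ m := by
  have hσz : σ z ≠ 0 := (map_ne_zero σ).2 hz
  have hvz0 : Valued.v z ≠ 0 := (Valuation.ne_zero_iff _).2 hz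
  have h20 : (2 : K) ≠ 0 := fun h => by rw [h, map_zero] at h2; exact zero_ne_one h2
  have key := congrArg Valued.v (familyZ_mul_eq σ hrel hz hσz h20 hb)
  rw [map_mul Valued.v (b * z) (2 * σ z), map_mul Valued.v (2 : K) (σ z), h2, hvσ, one_mul] at key
  -- `|c·(2σz) + c·xσx| ≤ |c|·|z|`
  have hR : Valued.v (c * (2 * σ z) + c * (x * σ x)) ≤ Valued.v c * Valued.v z := by
    refine Valued.v.map_add_le ?_ ?_
    · rw [map_mul, map_mul, h2, hvσ, one_mul]
    · rw [map_mul, map_mul, hvσ]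
      exact mul_le_mul' le_rfl (hxz.trans (mul_le_of_le_one_right' hvϖ1))
  rw [← key] at hR
  exact (le_of_mul_le_mul_v hR hvz0).trans hc

omit [ValuativeRel K] [(Valued.v : Valuation K ℤᵐ⁰).Compatible] in
include hvσ in
/-- **`|bz − c| ≤ |ϖ|^{m+1}`**: `|bz − c|·|2σz| = |c|·|x|² ≤ |ϖ|ᵐ·|z|·|ϖ|`. [cite: Serre1979, Ch. II §1] -/
theorem familyZ_v_sub_le {c x z b : K} (hrel : z + σ z + x * σ x = 0) (hc : Valued.v c ≤ Valued.v ϖ ^ m)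
    (hxz : Valued.v x * Valued.v x ≤ Valued.v z * Valued.v ϖ) (h2 : Valued.v (2 : K) = 1) (hz : z ≠ 0)
    (hb : b = c * (z⁻¹ - (σ z)⁻¹) / 2) :
    Valued.v (b * z - c) ≤ Valued.v ϖ ^ (m + 1) := by
  have hσz : σ z ≠ 0 := (map_ne_zero σ).2 hz
  have hvz0 : Valued.v z ≠ 0 := (Valuation.ne_zero_iff _).2 hz
  have h20 : (2 : K) ≠ 0 := fun h => by rw [h, map_zero] at h2; exact zero_ne_one h2
  have key := congrArg Valued.v (familyZ_sub_mul_eq σ hrel hz hσz h20 hb)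
  rw [map_mul Valued.v (b * z - c) (2 * σ z), map_mul Valued.v (2 : K) (σ z), h2, hvσ, one_mul,
    map_mul Valued.v c (x * σ x), map_mul Valued.v x (σ x), hvσ] at key
  have h : Valued.v (b * z - c) * Valued.v z ≤ Valued.v ϖ ^ (m + 1) * Valued.v z := by
    rw [key, pow_succ, mul_assoc, mul_comm (Valued.v ϖ) (Valued.v z)]
    exact mul_le_mul' hc hxz
  exact le_of_mul_le_mul_v h hvz0

/-! ## §2 The witness -/

include hJ hσ hvσ hvϖ hgn in
set_option maxHeartbeats 800000 in
-- one `u ∈ N`, its conjugate's four entries, six valuation bounds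
/-- **THE DEPTH WITNESS OF FAMILY Z.**  `ū ∈ U(σ, Φ₃)` with matrix `ū(x, z)` (`z + σz + xσx = 0`), `|x| ≤ |ϖ|`, `|ϖ|ᵐ ≤ |z| ≤ |ϖ|`, `|x|² ≤ |z||ϖ|`; `c` with `σc = c`, `|c| ≤ |ϖ|ᵐ`;
`|2| = 1`.  Then there is `u ∈ N` (matrix `u(0, b)`, `b = c(z⁻¹ − (σz)⁻¹)∕2`) with `ū⁻¹ u ū ∈ J_{m+1} = K₀ ⊓ g K₀ g⁻¹` (`g = diag(1,1,ϖ^{m+1})`) and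
`(ū⁻¹ u ū)₀₀ = (1 + c)(1 + ε)`, `|ε| ≤ |ϖ|^{m+1}` — so `θ(ū⁻¹ u ū) = χ₁(1 + c)` for `χ₁` of conductor `≤ m + 1`, while `(χδ^{½})(u) = 1`: the cell `P·ū·J_{m+1}` is θ-IRRELEVANT as soon as
`χ₁(1 + c) ≠ 1` for some such `c` (cond(`χ₁|_{F^×}`) = `m + 1`). [cite: Roche1998, §4] [cite: Casselman1995, §6.3] [cite: Rogawski1990, §1.10 p. 9] -/
theorem exists_familyZ_witness (hm : 1 ≤ m) {nb : ↥(unitaryGroupOfForm σ J)} {x z c : K}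
    (hnb : ((nb : GL (Fin 3) K) : Matrix (Fin 3) (Fin 3) K) = !![1, 0, 0; -σ x, 1, 0; z, x, 1]) (hrel : z + σ z + x * σ x = 0)
    (hx : Valued.v x ≤ Valued.v ϖ) (hz1 : Valued.v z ≤ Valued.v ϖ) (hzm : Valued.v ϖ ^ m ≤ Valued.v z)
    (hxz : Valued.v x * Valued.v x ≤ Valued.v z * Valued.v ϖ)
    (hσc : σ c = c) (hc : Valued.v c ≤ Valued.v ϖ ^ m) (h2 : Valued.v (2 : K) = 1) :
    ∃ u : ↥(unitaryGroupOfForm σ J), u ∈ unipotentU σ J ∧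
      nb⁻¹ * u * nb ∈ (glInt 3 K).subgroupOf (unitaryGroupOfForm σ J) ⊓ ((glInt 3 K).map (MulAut.conj gn).toMonoidHom).subgroupOf (unitaryGroupOfForm σ J) ∧
      ∃ ε : K, Valued.v ε ≤ Valued.v ϖ ^ (m + 1) ∧
        (((nb⁻¹ * u * nb : ↥(unitaryGroupOfForm σ J)) : GL (Fin 3) K) : Matrix (Fin 3) (Fin 3) K) 0 0 = (1 + c) * (1 + ε) := by
  have hϖ0 : ϖ ≠ 0 := CartanUnique.uniformizer_ne_zero hvϖ
  have hvϖ0 : Valued.v ϖ ≠ 0 := (Valuation.ne_zero_iff _).2 hϖ0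
  have hvϖ1 : Valued.v ϖ ≤ 1 := by rw [hvϖ, ← WithZero.exp_zero, WithZero.exp_le_exp]; norm_num
  have hvϖlt : Valued.v ϖ < 1 := by rw [hvϖ, ← WithZero.exp_zero, WithZero.exp_lt_exp]; norm_num
  have hvϖm : Valued.v ϖ ^ m ≤ 1 := pow_le_one' hvϖ1 m
  have hz : z ≠ 0 := fun h => by
    rw [h, map_zero] at hzm
    exact absurd hzm (not_le.2 (pow_pos (zero_lt_iff.2 hvϖ0) m))
  have hvz0 : Valued.v z ≠ 0 := (Valuation.ne_zero_iff _).2 hz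
  have hσz : σ z ≠ 0 := (map_ne_zero σ).2 hz
  have h20 : (2 : K) ≠ 0 := fun h => by rw [h, map_zero] at h2; exact zero_ne_one h2
  -- the element `u = u(0, b)`
  obtain ⟨b, hb⟩ : ∃ b : K, b = c * (z⁻¹ - (σ z)⁻¹) / 2 := ⟨_, rfl⟩
  obtain ⟨u, huN, hu⟩ := K2E3LowerUnipotentBigCellIntegral.exists_upper_of_rel σ hJ hσ (a := 0) (b := b) (familyZ_rel σ hσ hσc hb)
  -- valuations of `bz`, `b`
  have hvbz : Valued.v (b * z) ≤ Valued.v ϖ ^ m := familyZ_v_bz_le σ hvσ hrel hc hxz h2 hz hvϖ1 hb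
  have hvb : Valued.v b ≤ 1 := by
    rw [show b = b * z * z⁻¹ by rw [mul_inv_cancel_right₀ hz], map_mul, map_inv₀]
    calc Valued.v (b * z) * (Valued.v z)⁻¹ ≤ Valued.v z * (Valued.v z)⁻¹ := mul_le_mul' (hvbz.trans hzm) le_rfl
      _ = 1 := mul_inv_cancel₀ hvz0
  -- `u`, `ū`, hence `j = ū⁻¹ u ū`, are integral
  have hσ0 : Valued.v (-σ (0 : K)) ≤ 1 := by rw [map_zero, neg_zero, map_zero]; exact zero_le_one
  have huK : (u : GL (Fin 3) K) ∈ glInt 3 K := mem_glInt_of_coe_eq σ hJ hvσ hu fun i j => by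
    fin_cases i <;> fin_cases j <;> simp [hvb]
  have hnbK : (nb : GL (Fin 3) K) ∈ glInt 3 K :=
    mem_glInt_of_coe_eq_lower σ hJ hvσ hnb (hx.trans hvϖ1) (hz1.trans hvϖ1)
  have hjK : nb⁻¹ * u * nb ∈ (glInt 3 K).subgroupOf (unitaryGroupOfForm σ J) :=
    Subgroup.mul_mem _ (Subgroup.mul_mem _ (Subgroup.inv_mem _ (Subgroup.mem_subgroupOf.2 hnbK)) (Subgroup.mem_subgroupOf.2 huK))
      (Subgroup.mem_subgroupOf.2 hnbK)
  -- the four entries (family Z, `y = 0`)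
  obtain ⟨e00, e10, e20, e21⟩ := K2E3LowerUnipotentConjUpperEntries.conj_upper_entries_of_y_eq_zero σ hJ hσ hnb hu hrel rfl
  refine ⟨u, huN, ?_, ?_⟩
  · -- `j ∈ J_{m+1}` by the level test
    rw [K2E3IwahoriLevelNFactorisation.mem_glInt_inf_conj_glInt_pow_iff σ hJ hvσ hvϖ gn hgn]
    refine ⟨(mem_glInt_subgroupOf_iff σ hJ hvσ _).1 hjK, ?_, ?_, ?_⟩
    · -- `(2,0) = σz · bz`
      rw [e20, mul_assoc, map_mul, hvσ, pow_succ, mul_comm (Valued.v ϖ ^ m)]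
      exact mul_le_mul' hz1 hvbz
    · -- `(2,1) = σz · b · x = (bz) · x · (σz ∕ z)`: valuation `|bz|·|x|`
      rw [e21, show σ z * b * x = (b * z) * x * (σ z / z) by field_simp, map_mul, map_mul, map_div₀, hvσ, div_self hvz0, mul_one,
        pow_succ]
      exact mul_le_mul' hvbz hx
    · -- `(1,0) = σx · bz`
      rw [e10, mul_assoc, map_mul, hvσ, pow_succ, mul_comm (Valued.v ϖ ^ m)]
      exact mul_le_mul' hx hvbz
  · -- `j₀₀ = 1 + bz = (1 + c)(1 + ε)`, `ε = (bz − c)∕(1 + c)`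
    have hvϖmlt : Valued.v ϖ ^ m < 1 := pow_lt_one' hvϖlt (Nat.one_le_iff_ne_zero.1 hm)
    have hclt : Valued.v c < Valued.v (1 : K) := by rw [Valuation.map_one]; exact lt_of_le_of_lt hc hvϖmlt
    have h1c : Valued.v (1 + c) = 1 := by rw [Valuation.map_add_eq_of_lt_left _ hclt, Valuation.map_one]
    have h1c0 : (1 + c : K) ≠ 0 := fun h => by rw [h, map_zero] at h1c; exact zero_ne_one h1c
    refine ⟨(b * z - c) / (1 + c), ?_, ?_⟩
    · rw [map_div₀, h1c, div_one]
      exact familyZ_v_sub_le σ hvσ hrel hc hxz h2 hz hb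
    · rw [e00]
      field_simp
      ring

end Valuation

end Summit.HodgeConjecture.HodgeConjecture.Cruxes.H413.K2E3LevelNDepthWitnessZ

end
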